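import Mathlib

/-!
# `Balaban1983to89.HiggsLattice` — T. Bałaban, *(Higgs)₂,₃ quantum fields in a finite volume. I. A lower bound*,
Commun. Math. Phys. **85** (1982) 603–626 [Balaban1982Higgs1], Sect. 1 pp. 604–607: the lattice Higgs model
(tori, fields, difference and covariant derivatives, the actions (1.8)/(1.11), the partition function (1.10), blocks)
as CONCRETE Mathlib definitions — the shared vocabulary of the (Higgs)₂,₃ papers B1–B3 of the lit-balaban skeleton

statement-level skeleton of published theorems with citation tags; proofs where landed; nothing here is a claim about the Yang–Mills mass gap

PDF held: `paper:balaban1982-cmp85-higgs23-i` (journal page = PDF page + 602).  Every display below was read from the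
×2 page renders `run/shared/lean/pub/pub-balaban/b2b-balaban-ref1/pages/1982-cmp85-higgs23-I/1982-cmp85-higgs23-I-p002…p005-x2.png`
(pp. 604–607), never from the OCR layer.

CITATION HEADER (lean-in-tree rule).  This module belongs to the lit-balaban TYPED SKELETON (HOME
`run/shared/lean/pub/lit-balaban/`, LEAN-PLAN.md §1/§4, SHARED-STRUCTURES.md §3): it is the CARRIER module over which
the readers of B1 = [Balaban1982Higgs1], B2 = [Balaban1982Higgs2], B3 = [Balaban1983Higgs3] type their statements.
WHAT IS REPRODUCED, as definitions with bodies (no statement of the paper is asserted; the two lemmas are the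
one-line algebraic remarks printed on p. 605): the tori `T^{(k)}_{L^k ε}` of (1.2)/(1.19)–(1.20) with
`ε⁻¹ L_μ = L^K M L'_μ` (`Params`, `Site`, `Params.mesh`, `Site.coord`), the distance (1.3) (`Site.tdist`), scalar
fields `φ : T → ℝ^N` and vector fields on bonds with `A_{-b} = -A_b` (`ScalarField`, `VecField`, `PBond`, `Plaq`),
the difference derivative (1.4) (`sderiv`), the scalar products (1.5) (`siteInner`, `bondInner`), the derivative of a
bond function over a plaquette (1.6) (`curl`), the representation `U(A) = exp(qεeA)` with `q` antisymmetric,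
`‖q‖ ≤ 1` (p. 605; `ChargeData`, `ChargeData.U`) and its unitarity, the covariant derivative (1.7) (`covDeriv`),
the actions `S'^ε` (1.8) (`actionPrime`) and `S^ε` (1.11) (`action`, with `⟨φ,(−Δ^ε_A)φ⟩ = Σ_b ε^d |(D^ε_A φ)(b)|²`,
`−Δ^ε_A = D^{ε*}_A D^ε_A`, and `⟨A,(−Δ^ε)A⟩` componentwise, `−Δ^ε = ∂^{ε*}∂^ε`: `covLaplaceForm`, `vecLaplaceForm`),
the partition function (1.10) (`partitionFn`) and the free normalization (1.12) (`freeNormalization`), the volume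
`|Λ| = Σ_{x∈Λ} η^d` (1.21) (`Params.vol`), the blocks (1.17), the operation `B(Λ)` (1.18) and the inclusions
`T^{(k+1)} = (T^{(k)})'` (1.19) (`blockOf`, `block`, `blockSet`, `emb`).  DELIBERATELY NOT HERE (reader-owned rows of
the skeleton): the counterterms `δm²`, `E₁` (1.13) and the Theorem (1.14) p. 606; the rescalings (1.22)–(1.23); Sect. 2
(contours `Γ_{y,x}`, averaging `Q(A)`, `Q_k(A)`, the Gaussian renormalization transformations (2.4)–(2.11)) — planned
sibling carrier `…Balaban1983to89.HiggsAveraging`; Props. 2.1–2.3 are ALREADY typed in `…Balaban1983to89.B1` over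
B4's abstract carriers and are not restated.
RELATION TO EXISTING TREE VOCABULARY (reviewers please note; nothing is restated): `…Balaban1983to89.Setup`
(`Params`/`Site`/`PBond`/`Plaq`/`blockOf`) types B12 (0.1) — tori with EQUAL sides `2L^{m+K-j}`, CENTRED blocks (`L` odd),
group-valued bond variables; the (Higgs)₂,₃ papers use the tori (1.2) with PER-DIRECTION sides `2L^{K-k}ML'_μ` (the
extra large-block factor `M`), CORNER-anchored blocks (1.17) and real/`ℝ^N`-valued fields with Lebesgue measure, so the
two carriers are different objects; `…Balaban1983to89.B1` §ADDENDUM has `U(A)`, `D^ε_A`, `Q(A)` only as letters of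
abstract *-ring identities ((3.15)/(3.16)), not as operators.  CONVENTIONS: a site of `T^{(k)}` in direction `μ` is a
label `v ∈ ZMod (2L^{K-k}ML'_μ)` with real coordinate `x_μ = L^kε · (v.val − L^{K-k}ML'_μ)` (so `−L_μ ≤ x_μ < L_μ` as in
(1.2)); only POSITIVELY oriented bonds `⟨x, x + L^kε e_μ⟩` are stored, `A_{-b} = -A_b` (p. 604) is the reading
convention; the level index `k` is meaningful for `k ≤ K` (`Params.sitesPerDir` uses `K - k`; for `k > K` the tori
degenerate to `2ML'_μ` sites per direction — statements quantify `k ≤ K`).  Unit `lit-balaban-typer`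
(literature-prover-lit-balaban-typer-0); HOME/FILED.md records the proposal.
v1.1 (append-only, same unit): §6 the representation property of `U` printed on p. 605 — `ChargeData.U_add`
(`U(A+B) = U(A)U(B)`), `U_zero`, `U_mul_U_neg` — PROVED; no v1 declaration changed.
-/

open scoped BigOperators InnerProductSpace
open _root_.MeasureTheory NormedSpace

namespace Literature.MathematicalPhysics.QuantumFieldTheory.Balaban1983to89.HiggsLattice

/-! ## 1. The tori `T^{(k)}_{L^k ε}` ((1.2), (1.19)–(1.21)) -/

/-- The parameters of the finite-volume lattices of [Balaban1982Higgs1] (1.2) p. 604: dimension `d` (`d = 2, 3` in the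
paper; any `d ≥ 1` here), the lattice spacing `ε > 0`, and the positive integers `K, L, M, L'_μ` with
`ε⁻¹ L_μ = L^K M L'_μ` (*"where K, L, M, L'_μ are some positive integers, K = O(log ε⁻¹) and L, M will be described
later"*).  No size relation among them is fixed here (statements carry their own). [cite: Balaban1982Higgs1, (1.2) p.604] -/
structure Params where
  d : ℕ
  ε : ℝ
  K : ℕ
  L : ℕ
  M : ℕ
  Lp : Fin d → ℕ
  hd : 1 ≤ d
  hε : 0 < ε
  hL : 0 < L
  hM : 0 < M
  hLp : ∀ μ, 0 < Lp μ

namespace Params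

variable (P : Params)

/-- The mesh (spacing, scale `η`) `L^k ε` of the `k`-th lattice `T^{(k)}_{L^k ε}` ((1.19) p. 607; `k = 0` is `T_ε`). [cite: Balaban1982Higgs1, (1.19) p.607] -/
noncomputable def mesh (k : ℕ) : ℝ := (P.L : ℝ) ^ k * P.ε

/-- Number of sites of `T^{(k)}_{L^k ε} = T_ε ∩ L^kε ℤ^d` in direction `μ`: `2 L_μ / (L^k ε) = 2 L^{K-k} M L'_μ`
((1.2) with (1.19)–(1.20) p. 607; meaningful for `k ≤ K`). [cite: Balaban1982Higgs1, (1.20) p.607] -/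
def sitesPerDir (k : ℕ) (μ : Fin P.d) : ℕ := 2 * (P.L ^ (P.K - k) * P.M * P.Lp μ)

/-- The half-period `L^{K-k} M L'_μ = L_μ / (L^k ε)` in lattice units. [cite: Balaban1982Higgs1, (1.2) p.604] -/
def halfPerDir (k : ℕ) (μ : Fin P.d) : ℕ := P.L ^ (P.K - k) * P.M * P.Lp μ

/-- `sitesPerDir = 2 · halfPerDir` (definitional). [cite: Balaban1982Higgs1, (1.2) p.604] -/
theorem sitesPerDir_eq (k : ℕ) (μ : Fin P.d) : P.sitesPerDir k μ = 2 * P.halfPerDir k μ := rfl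

/-- The site counts `2L^{K-k}ML'_μ` are positive ((1.2) p. 604: *"K, L, M, L'_μ are some positive integers"*). [cite: Balaban1982Higgs1, (1.2) p.604] -/
theorem sitesPerDir_pos (k : ℕ) (μ : Fin P.d) : 0 < P.sitesPerDir k μ := by
  unfold sitesPerDir
  have h1 : 0 < P.L ^ (P.K - k) := pow_pos P.hL _
  have h2 := P.hM
  have h3 := P.hLp μ
  positivity

/-- `NeZero` instance for the site counts (needed by `ZMod`). [folklore] -/
instance (k : ℕ) (μ : Fin P.d) : NeZero (P.sitesPerDir k μ) := ⟨(P.sitesPerDir_pos k μ).ne'⟩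

/-- The meshes `L^kε` are positive (`ε > 0`, `L` a positive integer, (1.2) p. 604). [cite: Balaban1982Higgs1, (1.2) p.604] -/
theorem mesh_pos (k : ℕ) : 0 < P.mesh k := by
  unfold mesh
  have : (0 : ℝ) < P.L := by exact_mod_cast P.hL
  exact mul_pos (pow_pos this _) P.hε

end Params

/-- Sites of the torus `T^{(k)}_{L^k ε}` ((1.2)/(1.19)): `d` labels, the `μ`-th modulo `2 L^{K-k} M L'_μ`; the label `v`
stands for the coordinate `x_μ = L^kε (v − L^{K-k}ML'_μ) ∈ [−L_μ, L_μ)` (`Site.coord`). [cite: Balaban1982Higgs1, (1.2) p.604] -/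
def Site (P : Params) (k : ℕ) : Type := (μ : Fin P.d) → ZMod (P.sitesPerDir k μ)

namespace Site

variable {P : Params} {k : ℕ}

/-- The sites of a finite torus form a finite type. [folklore] -/
instance : Fintype (Site P k) := inferInstanceAs (Fintype ((μ : Fin P.d) → ZMod (P.sitesPerDir k μ)))

/-- Decidable equality of sites. [folklore] -/
instance : DecidableEq (Site P k) := inferInstanceAs (DecidableEq ((μ : Fin P.d) → ZMod (P.sitesPerDir k μ)))

/-- The site of label `0` (coordinate `−L_μ` in every direction) as default. [folklore] -/
instance : Inhabited (Site P k) := ⟨fun _ => 0⟩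

/-- The real coordinates `x_μ ∈ L^kε ℤ`, `−L_μ ≤ x_μ < L_μ`, of a site ((1.2) p. 604). [cite: Balaban1982Higgs1, (1.2) p.604] -/
noncomputable def coord (x : Site P k) (μ : Fin P.d) : ℝ :=
  P.mesh k * (((x μ).val : ℝ) - (P.halfPerDir k μ : ℝ))

/-- `x + L^kε e_μ` (nearest neighbour in direction `μ`, periodically). [cite: Balaban1982Higgs1, (1.2) p.604] -/
def shift (x : Site P k) (μ : Fin P.d) : Site P k := Function.update x μ (x μ + 1)

/-- `x − L^kε e_μ`. [cite: Balaban1982Higgs1, (1.2) p.604] -/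
def unshift (x : Site P k) (μ : Fin P.d) : Site P k := Function.update x μ (x μ - 1)

/-- The torus distance (1.3) p. 604, `|x − y| = max_μ min{|x_μ − y_μ|, 2L_μ − |x_μ − y_μ|}`, in LATTICE UNITS of
`T^{(k)}` (the printed distance is `L^kε · tdist x y`). [cite: Balaban1982Higgs1, (1.3) p.604] -/
def tdist (x y : Site P k) : ℕ :=
  Finset.univ.sup fun μ : Fin P.d => min (x μ - y μ).val (y μ - x μ).val

end Site

/-- The volume `|Λ| = Σ_{x ∈ Λ} η^d` of a set of sites of the `η = L^kε` lattice ((1.21) p. 607: *"= η^d (a number of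
points in Λ)"*). [cite: Balaban1982Higgs1, (1.21) p.607] -/
noncomputable def Params.vol (P : Params) (k : ℕ) (Λ : Finset (Site P k)) : ℝ := P.mesh k ^ P.d * (Λ.card : ℝ)

/-- Positively oriented bonds `b = ⟨b₋, b₊⟩ = ⟨x, x + L^kε e_μ⟩` of `T^{(k)}` (p. 604: *"T*_ε is the set of all bonds …
b = ⟨b₋, b₊⟩ where b₋ is the initial point, b₊ is the final point"*; the oppositely oriented bond `−b` is not a separate
element: `A_{−b} = −A_b`). [cite: Balaban1982Higgs1, (1.4) p.604] -/
structure PBond (P : Params) (k : ℕ) where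
  src : Site P k
  dir : Fin P.d

namespace PBond

variable {P : Params} {k : ℕ}

/-- The final point `b₊ = b₋ + L^kε e_μ`. [cite: Balaban1982Higgs1, (1.4) p.604] -/
def tgt (b : PBond P k) : Site P k := b.src.shift b.dir

/-- Bonds form a finite type (`≃ sites × directions`). [folklore] -/
instance : Fintype (PBond P k) :=
  Fintype.ofEquiv (Site P k × Fin P.d) ⟨fun p => ⟨p.1, p.2⟩, fun b => (b.src, b.dir), fun _ => rfl, fun _ => rfl⟩

end PBond

/-- Plaquettes `P = ⟨x, x + εe_μ, x + εe_μ + εe_ν, x + εe_ν⟩`, `μ < ν` (p. 604, after (1.6)). [cite: Balaban1982Higgs1, (1.6) p.604] -/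
structure Plaq (P : Params) (k : ℕ) where
  src : Site P k
  μ : Fin P.d
  ν : Fin P.d
  hμν : μ < ν

namespace Plaq

variable {P : Params} {k : ℕ}

/-- Plaquettes form a finite type. [folklore] -/
instance : Fintype (Plaq P k) :=
  Fintype.ofEquiv {t : Site P k × Fin P.d × Fin P.d // t.2.1 < t.2.2}
    ⟨fun t => ⟨t.1.1, t.1.2.1, t.1.2.2, t.2⟩, fun p => ⟨(p.src, p.μ, p.ν), p.hμν⟩, fun _ => rfl, fun _ => rfl⟩

end Plaq

/-! ## 2. Blocks ((1.16)–(1.20)) -/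

section Blocks

variable {P : Params} {k : ℕ}

/-- The block map `T^{(k)} → T^{(k+1)}`: `x ∈ B(y)` iff `y_μ ≤ x_μ < y_μ + L·(L^kε)` ((1.17) p. 606, CORNER-anchored
blocks); in labels this is coordinatewise integer division by `L` (valid for `k < K`, where
`sitesPerDir k μ = L · sitesPerDir (k+1) μ`). [cite: Balaban1982Higgs1, (1.17) p.606] -/
def blockOf (x : Site P k) : Site P (k + 1) :=
  fun μ => (((x μ).val / P.L : ℕ) : ZMod (P.sitesPerDir (k + 1) μ))

/-- The inclusion `T^{(k+1)}_{L^{k+1}ε} = (T^{(k)}_{L^kε})' = T^{(k)} ∩ L^{k+1}ε ℤ^d ⊂ T^{(k)}` ((1.16), (1.19) p. 606–607):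
label `w ↦ L·w`. [cite: Balaban1982Higgs1, (1.19) p.607] -/
def emb (y : Site P (k + 1)) : Site P k :=
  fun μ => (((y μ).val * P.L : ℕ) : ZMod (P.sitesPerDir k μ))

/-- The block `B(y) = {x ∈ T^{(k)} : y_μ ≤ x_μ < y_μ + L^{k+1}ε}` of `y ∈ T^{(k+1)}` ((1.17) p. 606), as a `Finset`. [cite: Balaban1982Higgs1, (1.17) p.606] -/
def block (y : Site P (k + 1)) : Finset (Site P k) := Finset.univ.filter fun x => blockOf x = y

/-- The operation `B(Λ) = ⋃_{y ∈ Λ} B(y)` ((1.18) p. 607) on finite sets of coarse sites. [cite: Balaban1982Higgs1, (1.18) p.607] -/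
def blockSet (Λ : Finset (Site P (k + 1))) : Finset (Site P k) := Finset.univ.filter fun x => blockOf x ∈ Λ

/-- `x ∈ B(Λ)` iff the block of `x` lies in `Λ` (definitional unfolding of (1.18)). [cite: Balaban1982Higgs1, (1.18) p.607] -/
theorem mem_blockSet (Λ : Finset (Site P (k + 1))) (x : Site P k) : x ∈ blockSet Λ ↔ blockOf x ∈ Λ := by
  simp [blockSet]

end Blocks

/-! ## 3. Fields, difference derivatives, scalar products ((1.4)–(1.6)) -/

/-- Scalar field configurations `φ : T^{(k)} → ℝ^N` (p. 604). [cite: Balaban1982Higgs1, (1.5) p.604] -/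
abbrev ScalarField (P : Params) (k : ℕ) (N : ℕ) : Type := Site P k → EuclideanSpace ℝ (Fin N)

/-- Vector field configurations `A : T*^{(k)} → ℝ` on positively oriented bonds, `A_{⟨x, x+εe_μ⟩} = A_μ(x)`,
`A_{−b} = −A_b` (p. 604). [cite: Balaban1982Higgs1, (1.4) p.604] -/
abbrev VecField (P : Params) (k : ℕ) : Type := PBond P k → ℝ

section Operators

variable {P : Params} {k : ℕ}

/-- The `μ`-th component `A_μ : T^{(k)} → ℝ`, `A_μ(x) = A_{⟨x, x+εe_μ⟩}` of a vector field (p. 604). [cite: Balaban1982Higgs1, (1.4) p.604] -/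
def VecField.comp (A : VecField P k) (μ : Fin P.d) : Site P k → ℝ := fun x => A ⟨x, μ⟩

/-- The difference derivative (1.4) p. 604: `(∂^η f)(b) = η⁻¹ (f(b₊) − f(b₋))`, `η = L^kε`, for a function on sites
with values in a real vector space. [cite: Balaban1982Higgs1, (1.4) p.604] -/
noncomputable def sderiv {V : Type*} [AddCommGroup V] [Module ℝ V] (f : Site P k → V) (b : PBond P k) : V :=
  (P.mesh k)⁻¹ • (f b.tgt - f b.src)

/-- The scalar product (1.5) p. 604 on site functions, `⟨f, g⟩ = Σ_{x ∈ T} η^d f(x)·g(x)` (values in a real inner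
product space; `η = L^kε`, cf. p. 607: *"(1.5) with η instead of ε"*). [cite: Balaban1982Higgs1, (1.5) p.604] -/
noncomputable def siteInner {E : Type*} [NormedAddCommGroup E] [InnerProductSpace ℝ E] (f g : Site P k → E) : ℝ :=
  ∑ x : Site P k, P.mesh k ^ P.d * ⟪f x, g x⟫_ℝ

/-- The scalar product (1.5) on bond functions, `⟨f, g⟩ = Σ_{b} η^d f(b)·g(b)` (p. 607: *"for the functions defined
on the points of the lattice ηℤ^d or on the bonds of this lattice"*). [cite: Balaban1982Higgs1, (1.5) p.604] -/
noncomputable def bondInner {E : Type*} [NormedAddCommGroup E] [InnerProductSpace ℝ E] (f g : PBond P k → E) : ℝ :=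
  ∑ b : PBond P k, P.mesh k ^ P.d * ⟪f b, g b⟫_ℝ

/-- The derivative of a bond function over a plaquette, (1.6) p. 604:
`(∂^η A)(P) = η⁻¹ Σ_{b ⊂ ∂P} A_b = (∂^η_μ A_ν)(x) − (∂^η_ν A_μ)(x)` for `P = ⟨x, x+ηe_μ, x+ηe_μ+ηe_ν, x+ηe_ν⟩`, i.e.
`η⁻¹ (A_μ(x) + A_ν(x+ηe_μ) − A_μ(x+ηe_ν) − A_ν(x))` with the orientation convention `A_{−b} = −A_b`. [cite: Balaban1982Higgs1, (1.6) p.604] -/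
noncomputable def curl (A : VecField P k) (p : Plaq P k) : ℝ :=
  (P.mesh k)⁻¹ * (A ⟨p.src, p.μ⟩ + A ⟨p.src.shift p.μ, p.ν⟩ - A ⟨p.src.shift p.ν, p.μ⟩ - A ⟨p.src, p.ν⟩)

end Operators

/-! ## 4. The representation `U(A) = exp(qεeA)` and the covariant derivative ((1.7)) -/

/-- The coupling of scalar and vector fields (p. 605): *"a representation of the additive group of real numbers R in
unitary operators on R^N: U(A) = exp(qεeA), A ∈ R, where e is a coupling constant and q is an antisymmetric N × N
matrix. We will assume only that ‖q‖ ≤ 1."*  (`q` as an operator on `ℝ^N`, antisymmetry as `q* = −q`.) [cite: Balaban1982Higgs1, (1.7) p.605] -/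
structure ChargeData (N : ℕ) where
  e : ℝ
  q : EuclideanSpace ℝ (Fin N) →L[ℝ] EuclideanSpace ℝ (Fin N)
  q_skew : star q = -q
  norm_q_le : ‖q‖ ≤ 1

namespace ChargeData

variable {N : ℕ} (C : ChargeData N)

/-- `U(A) = exp(q η e A)` for a bond variable `A ∈ ℝ` on a lattice of spacing `η` (p. 605; on `T^{(k)}`, `η = L^kε`). [cite: Balaban1982Higgs1, (1.7) p.605] -/
noncomputable def U (η A : ℝ) : EuclideanSpace ℝ (Fin N) →L[ℝ] EuclideanSpace ℝ (Fin N) :=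
  exp ((η * C.e * A) • C.q)

/-- p. 605: *"Antisymmetry of q implies U(A)* = U(−A)"*. [cite: Balaban1982Higgs1, (1.7) p.605] -/
theorem star_U (η A : ℝ) : star (C.U η A) = C.U η (-A) := by
  unfold U
  rw [star_exp, star_smul, C.q_skew, star_trivial, smul_neg, ← neg_smul]
  congr 1
  ring

/-- p. 605: `U(A)` is unitary (*"U(A)* = U(−A) = U(−A)⁻¹"*, i.e. `U(A)* U(A) = U(A) U(A)* = 1`). [cite: Balaban1982Higgs1, (1.7) p.605] -/
theorem U_mem_unitary (η A : ℝ) : C.U η A ∈ unitary (EuclideanSpace ℝ (Fin N) →L[ℝ] EuclideanSpace ℝ (Fin N)) := by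
  letI : NormedAlgebra ℚ (EuclideanSpace ℝ (Fin N) →L[ℝ] EuclideanSpace ℝ (Fin N)) :=
    NormedAlgebra.restrictScalars ℚ ℝ _
  unfold U
  exact exp_mem_unitary_of_mem_skewAdjoint (by
    rw [skewAdjoint.mem_iff, star_smul, C.q_skew, star_trivial, smul_neg])

end ChargeData

section Covariant

variable {P : Params} {k N : ℕ}

/-- The covariant derivative (1.7) p. 605: `(D^η_A φ)(b) = η⁻¹ (U(A_b) φ(b₊) − φ(b₋))`, `b = ⟨b₋, b₊⟩`. [cite: Balaban1982Higgs1, (1.7) p.605] -/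
noncomputable def covDeriv (C : ChargeData N) (A : VecField P k) (φ : ScalarField P k N) (b : PBond P k) :
    EuclideanSpace ℝ (Fin N) :=
  (P.mesh k)⁻¹ • (C.U (P.mesh k) (A b) (φ b.tgt) - φ b.src)

/-- At `A = 0` the covariant derivative is the difference derivative (1.4) (`U(0) = 1`). [cite: Balaban1982Higgs1, (1.7) p.605] -/
theorem covDeriv_zero (C : ChargeData N) (φ : ScalarField P k N) (b : PBond P k) :
    covDeriv C (0 : VecField P k) φ b = sderiv φ b := by
  unfold covDeriv sderiv ChargeData.U
  have hz : P.mesh k * C.e * (0 : VecField P k) b = 0 := by simp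
  have h0 : (P.mesh k * C.e * (0 : VecField P k) b) • C.q = 0 := by
    rw [hz]; exact zero_smul ℝ C.q
  rw [h0, exp_zero]
  rfl

end Covariant

/-! ## 5. The actions (1.8), (1.11), the partition function (1.10), the free normalization (1.12) -/

/-- The constants of the action (1.8)/(1.11) p. 605: `m₀² = m² + δm²` (the bare mass INCLUDING the counterterm — any
real number here), `λ`, `μ₀²`, and the constant `E = E₀ + E₁` of (1.11).  The paper's standing assumptions
*"μ₀² > 0 and λ > 0"* are hypotheses of its statements, not fields. [cite: Balaban1982Higgs1, (1.11) p.605] -/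
structure Couplings where
  m0sq : ℝ
  lam : ℝ
  mu0sq : ℝ
  E : ℝ

section Actions

variable {P : Params} {k N : ℕ}

/-- The quadratic form of the covariant Laplace operator, `⟨φ, (−Δ^η_A) φ⟩ = Σ_b η^d |(D^η_A φ)(b)|²`
(p. 605: *"−Δ^ε_A = D^{ε*}_A D^ε_A is the covariant Laplace operator"*, with (1.5)). [cite: Balaban1982Higgs1, (1.11) p.605] -/
noncomputable def covLaplaceForm (C : ChargeData N) (A : VecField P k) (φ : ScalarField P k N) : ℝ :=
  ∑ b : PBond P k, P.mesh k ^ P.d * ‖covDeriv C A φ b‖ ^ 2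

/-- The quadratic form of the Laplace operator on vector fields, `⟨A, (−Δ^η) A⟩ = Σ_μ Σ_b η^d ((∂^η A_μ)(b))²`
(p. 605: *"−Δ^ε = ∂^{ε*}∂^ε is the Laplace operator on the torus T_ε"*, acting on `A : T_ε → ℝ^d` componentwise —
the Feynman-gauge form of (1.11)). [cite: Balaban1982Higgs1, (1.11) p.605] -/
noncomputable def vecLaplaceForm (A : VecField P k) : ℝ :=
  ∑ μ : Fin P.d, ∑ b : PBond P k, P.mesh k ^ P.d * (sderiv (A.comp μ) b) ^ 2

/-- The scalar self-interaction `Σ_{x ∈ T} η^d (½ m₀² |φ(x)|² + λ |φ(x)|⁴)` common to (1.8) and (1.11). [cite: Balaban1982Higgs1, (1.8) p.605] -/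
noncomputable def potential (c : Couplings) (φ : ScalarField P k N) : ℝ :=
  ∑ x : Site P k, P.mesh k ^ P.d * (c.m0sq / 2 * ‖φ x‖ ^ 2 + c.lam * ‖φ x‖ ^ 4)

/-- The action (1.8) p. 605:
`S'^ε(A, φ) = ½ Σ_b ε^d |(D^ε_A φ)(b)|² + Σ_x ε^d (½ m₀² |φ(x)|² + λ|φ(x)|⁴) + ½ Σ_P ε^d |(∂^ε A)(P)|² + ½ Σ_b ε^d μ₀² |A_b|²`
(the constant `E` does not occur in (1.8)). [cite: Balaban1982Higgs1, (1.8) p.605] -/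
noncomputable def actionPrime (C : ChargeData N) (c : Couplings) (A : VecField P k) (φ : ScalarField P k N) : ℝ :=
  covLaplaceForm C A φ / 2 + potential c φ
    + (∑ p : Plaq P k, P.mesh k ^ P.d * (curl A p) ^ 2) / 2
    + (∑ b : PBond P k, P.mesh k ^ P.d * (c.mu0sq * (A b) ^ 2)) / 2

/-- The (Feynman-gauge) action (1.11) p. 605:
`S^ε(A, φ) = ½⟨φ, (−Δ^ε_A)φ⟩ + Σ_x ε^d (½ m₀²|φ(x)|² + λ|φ(x)|⁴) + ½⟨A, (−Δ^ε + μ₀²)A⟩ + E`. [cite: Balaban1982Higgs1, (1.11) p.605] -/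
noncomputable def action (C : ChargeData N) (c : Couplings) (A : VecField P k) (φ : ScalarField P k N) : ℝ :=
  covLaplaceForm C A φ / 2 + potential c φ
    + (vecLaplaceForm A + ∑ b : PBond P k, P.mesh k ^ P.d * (c.mu0sq * (A b) ^ 2)) / 2 + c.E

/-- The partition function (1.10) p. 605, `Z^ε = ∫ dA ∫ dφ exp(−S^ε(A, φ))`, with *"the natural Lebesgue measure …
on the spaces of configurations of scalar and vector fields"* (product Lebesgue measure on `(bonds → ℝ) × (sites → ℝ^N)`). [cite: Balaban1982Higgs1, (1.10) p.605] -/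
noncomputable def partitionFn (P : Params) (k N : ℕ) (C : ChargeData N) (c : Couplings) : ℝ :=
  ∫ Φ : VecField P k × ScalarField P k N, Real.exp (-action C c Φ.1 Φ.2)

/-- The free normalization constant `E₀` of (1.12) p. 606:
`∫dA exp(−½⟨A,(−Δ^ε+μ₀²)A⟩) ∫dφ exp(−½⟨φ,(−Δ^ε_0+m²)φ⟩) = exp(E₀)` (the action (1.11) at `e = λ = 0`, `E = 0`,
`m₀² = m²`), defined as the logarithm of the left-hand side. [cite: Balaban1982Higgs1, (1.12) p.606] -/
noncomputable def freeNormalization (P : Params) (k N : ℕ) (C : ChargeData N) (msq mu0sq : ℝ) : ℝ :=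
  Real.log (partitionFn P k N { C with e := 0 } ⟨msq, 0, mu0sq, 0⟩)

/-- (1.8) and (1.11) have the same scalar part: at `E = 0` they differ only in the vector-field kinetic term
(`½ Σ_P ε^d |∂A(P)|²` versus the Feynman-gauge `½⟨A, −Δ A⟩`; p. 605: gauge fixing after [5]). [cite: Balaban1982Higgs1, (1.11) p.605] -/
theorem action_sub_actionPrime (C : ChargeData N) (c : Couplings) (A : VecField P k) (φ : ScalarField P k N) :
    action C c A φ - actionPrime C c A φ
      = (vecLaplaceForm A - ∑ p : Plaq P k, P.mesh k ^ P.d * (curl A p) ^ 2) / 2 + c.E := by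
  unfold action actionPrime
  ring

end Actions

/-! ## 6. The representation property of `U` (p. 605) — append-only addition v1.1 (lit-balaban typer) -/

namespace ChargeData

variable {N : ℕ} (C : ChargeData N)

/-- p. 605: `U` is *"a representation of the additive group of real numbers R in unitary operators on R^N"*:
`U(A + B) = U(A) U(B)` (the multiples of `q` commute).  This is the hypothesis `U((A+B)(Γ)) = U(A(Γ))U(B(Γ))` of
the tree's `B1.display315` ((3.15) p. 614) for the concrete model. PROVED. [cite: Balaban1982Higgs1, (1.7) p.605] -/
theorem U_add (η A B : ℝ) : C.U η (A + B) = C.U η A * C.U η B := by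
  letI : NormedAlgebra ℚ (EuclideanSpace ℝ (Fin N) →L[ℝ] EuclideanSpace ℝ (Fin N)) :=
    NormedAlgebra.restrictScalars ℚ ℝ _
  unfold U
  have hsplit : (η * C.e * (A + B)) • C.q = (η * C.e * A) • C.q + (η * C.e * B) • C.q := by
    rw [show η * C.e * (A + B) = η * C.e * A + η * C.e * B by ring]
    exact add_smul (η * C.e * A) (η * C.e * B) C.q
  have hc : Commute ((η * C.e * A) • C.q) ((η * C.e * B) • C.q) := by
    refine ContinuousLinearMap.ext fun v => ?_
    change (η * C.e * A) • C.q ((η * C.e * B) • C.q v) = (η * C.e * B) • C.q ((η * C.e * A) • C.q v)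
    rw [map_smul, map_smul, smul_smul, smul_smul, mul_comm]
  rw [hsplit]
  exact exp_add_of_commute hc

/-- p. 605: `U(0) = 1` (the representation at the identity of `(R, +)`). PROVED. [cite: Balaban1982Higgs1, (1.7) p.605] -/
theorem U_zero (η : ℝ) : C.U η 0 = 1 := by
  unfold U
  have hz : (η * C.e * 0) • C.q = 0 := by
    rw [mul_zero]
    exact zero_smul ℝ C.q
  rw [hz, exp_zero]

/-- p. 605: `U(−A) = U(A)⁻¹` in the sense `U(A) U(−A) = 1` (*"U(A)* = U(−A) = U(−A)⁻¹"* with `star_U`). PROVED. [cite: Balaban1982Higgs1, (1.7) p.605] -/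
theorem U_mul_U_neg (η A : ℝ) : C.U η A * C.U η (-A) = 1 := by
  rw [← U_add, add_neg_cancel, U_zero]

end ChargeData

end Literature.MathematicalPhysics.QuantumFieldTheory.Balaban1983to89.HiggsLattice
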